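import Summits.ValiantsHypothesis.ValiantsHypothesis.Theses.FermionizationDimension
import Summits.ValiantsHypothesis.ValiantsHypothesis.Theses.TwistedDetRank
import Summits.ValiantsHypothesis.ValiantsHypothesis.Theorems.FermionizationDimensionSDimPerNotQPExpansionBound

/-!
# Route FermionizationDimension — crux `SDimPerNotQP` (stmt-ValiantsHypothesis-7286):
# the polylogarithmic shadow of the crux from the semisimple stub alone

Auxiliary registered stub `stub_polylogTransfer` of the line `registered` of
`Cruxes/SDimPerNotQP/Lines/birth.lean`. The line proves the crux `SDimPerNotQP` ("the commutative
twisting dimension `s(n)` of the permanent is not quasi-polynomially bounded") from X1_ss =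
`TwistedDetRank.TdrPerNotQP` (the twisted-determinantal rank `tdr(per_n)` is not quasi-polynomially
bounded, open sibling crux stmt-ValiantsHypothesis-6284) and the transfer bet J_tr
(semisimplification at quasi-polynomial cost). WITHOUT the bet, the unconditional expansion bound
`tdr(per_n) ≤ (n+1)^d d^d` for a realisation of dimension `d` (`stub_expansionBound`,
Theorems/FermionizationDimensionSDimPerNotQPExpansionBound.lean) already transfers X1_ss to the
POLYLOGARITHMIC scale: `TdrPerNotQP →` for every `K` some `n` has every commutative realisation of
`sgn_n` of dimension `> (log₂ n)^K`. Indeed `d ≤ (log₂ n)^K` for all `n` would give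
`tdr(per_n) ≤ (n+1)^d d^d ≤ 2^((log₂ n + K + 3)^(K+3))` (`pow_mul_pow_le_qp`), a quasi-polynomial
bound. The gap between `(log₂ n)^K` and `2^((log₂ n + c)^c)` is exactly what J_tr must supply.

Sources: folklore.
-/

-- `Summit.<Summit>.<Problem>` repeats `ValiantsHypothesis` by the tree's layout convention (D-0017).
set_option linter.dupNamespace false

namespace Summit.ValiantsHypothesis.ValiantsHypothesis.Theorems

namespace FermionizationDimensionSDimPerNotQPPolylogTransfer

/-- Arithmetic of the polylog transfer: if `d ≤ L^K` with `L = log₂ n` then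
`(n+1)^d · d^d ≤ 2^((L + K + 3)^(K+3))`. [folklore] -/
theorem pow_mul_pow_le_qp (n d K : ℕ) (hd : d ≤ Nat.log 2 n ^ K) :
    (n + 1) ^ d * d ^ d ≤ 2 ^ ((Nat.log 2 n + (K + 3)) ^ (K + 3)) := by
  have hn : n + 1 ≤ 2 ^ (Nat.log 2 n + 1) := Nat.lt_pow_succ_log_self Nat.one_lt_two n
  generalize Nat.log 2 n = L at hn hd ⊢
  set M : ℕ := L + (K + 3) with hM
  have hL2 : L ≤ 2 ^ L := (Nat.lt_two_pow_self).le
  have hLK : L ^ K ≤ 2 ^ (L * K) := by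
    rw [pow_mul]; exact Nat.pow_le_pow_left hL2 K
  have hd2 : d ≤ 2 ^ (L * K) := hd.trans hLK
  -- both factors are powers of two
  have h1 : (n + 1) ^ d ≤ 2 ^ ((L + 1) * d) := by
    rw [pow_mul]; exact Nat.pow_le_pow_left hn d
  have h2 : d ^ d ≤ 2 ^ (L * K * d) := by
    rw [pow_mul]; exact Nat.pow_le_pow_left hd2 d
  -- the exponent is at most `M^(K+3)`
  have hexp : (L + 1) * d + L * K * d ≤ M ^ (K + 3) := by
    have e1 : (L + 1) * d + L * K * d = d * (L + 1 + L * K) := by ring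
    have e2 : L + 1 + L * K ≤ M * M := by nlinarith
    have e3 : d ≤ M ^ K := hd.trans (Nat.pow_le_pow_left (by omega) K)
    calc (L + 1) * d + L * K * d = d * (L + 1 + L * K) := e1
      _ ≤ M ^ K * (M * M) := Nat.mul_le_mul e3 e2
      _ = M ^ (K + 2) := by ring
      _ ≤ M ^ (K + 3) := Nat.pow_le_pow_right (by omega) (by omega)
  calc (n + 1) ^ d * d ^ d ≤ 2 ^ ((L + 1) * d) * 2 ^ (L * K * d) := Nat.mul_le_mul h1 h2
    _ = 2 ^ ((L + 1) * d + L * K * d) := (pow_add _ _ _).symm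
    _ ≤ 2 ^ M ^ (K + 3) := Nat.pow_le_pow_right (by norm_num) hexp

end FermionizationDimensionSDimPerNotQPPolylogTransfer

open FermionizationDimensionSDimPerNotQPPolylogTransfer in
/-- **Polylog transfer** (auxiliary registered stub `stub_polylogTransfer` of the line `registered`
of crux `SDimPerNotQP`, stmt-ValiantsHypothesis-7286): if `tdr(per_n)` is not quasi-polynomially
bounded (`TwistedDetRank.TdrPerNotQP`) then the commutative twisting dimension of the permanent
is not polylogarithmically bounded — for every `K` there is an `n` at which every commutative
realisation of `sgn_n` has dimension `> (log₂ n)^K`. The crux itself asks for the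
quasi-polynomial scale. [folklore] -/
theorem stub_polylogTransfer :
    Summit.ValiantsHypothesis.ValiantsHypothesis.Theses.TwistedDetRank.TdrPerNotQP → ∀ K : ℕ, ∃ n : ℕ, ∀ (R : Type) [CommRing R] [Algebra ℂ R] [Module.Finite ℂ R] (u : Fin n → Fin n → R) (ℓ : R →ₗ[ℂ] ℂ), (∀ σ : Equiv.Perm (Fin n), ℓ (∏ i, u (σ i) i) = ((Equiv.Perm.sign σ : ℤ) : ℂ)) → Nat.log 2 n ^ K < Module.finrank ℂ R := by
  intro hT K
  by_contra hcon
  push Not at hcon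
  apply hT
  refine ⟨K + 3, fun n => ?_⟩
  obtain ⟨R, _, _, _, u, ℓ, hu, hd⟩ := hcon n
  obtain ⟨r, hr, E, hE⟩ := stub_expansionBound n R u ℓ hu
  exact ⟨r, hr.trans (pow_mul_pow_le_qp n _ K hd), E, hE⟩

end Summit.ValiantsHypothesis.ValiantsHypothesis.Theorems
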